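import Summits.Ventures.GridStability.Lyapunov.StructurePreservingPolytopeUnique
import Summits.Ventures.GridStability.Lyapunov.StructurePreservingRoa
import Literature.Analysis.ODE.LyapunovBarbashinKrasovskii
import HarnessLib

/-!
# GridStability/Lyapunov/StructurePreservingPolytopeRoa — synchronisation of the structure-preserving
# model from Vu–Turitsyn's polytope: the energy well `{x ∈ 𝒫 ∩ leaf : V ≤ c}` for every level below
# the closed-form per-edge threshold `min_e b_e·vtGap(σ*_e)` is carried to the equilibrium
# (solver-free; every damping pattern; every coupling graph) — part 3, the assembly

Cell `gridfusion` (LADDER-GRIDFUSION), seat gridfusion-lyap-1 (g6); brief «SP-POLYTOPE» (lead RULING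
6i (5) «LFF-NU-SPARSE» as repaired on INBOX 2026-08-27: «a solver-free synchronisation-region THEOREM
at 39-bus SP size»). Parts 1–2: `StructurePreservingPolytope.lean` (`vtPolytope`, edge bound,
`isCompact_vtSublevel`), `StructurePreservingPolytopeUnique.lean`
(`eq_equilibrium_of_fderiv_eq_zero_vtPolytope`). HERE the three sentences of the route of record
`StructurePreservingRoa.lean` (p475989: [cite: BergenHill1981]; [cite: Padiyar2013, §3.2 Remark 2])
are re-proved with the phase-cohesive WINDOW `|δᵢ − δⱼ| < π/2` replaced by Vu–Turitsyn's POLYTOPE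
`|(δᵢ − δⱼ) + (δ₀ᵢ − δ₀ⱼ)| < π` [cite: VuTuritsyn2016, §IV] and the window threshold
`c⋆(θ, β) = (1 − sin θ)·β·(π/2 − θ)/4` replaced by the PER-EDGE closed-form level
`c < bᵢⱼ·vtGap(δ₀ᵢ − δ₀ⱼ)` on every coupled pair, `vtGap d = 2 cos d − (π − 2|d|) sin|d|`
[cite: VuTuritsyn2016, §IV third construction and Appendix 9.3] — the same mechanism
(`Literature.Analysis.ODE.sublevel_subset_regionOfAttraction_of_noCompleteTrajectory`, lit-6 p463197,
[cite: RoucheHabetsLaloy1977, Ch. II Thm 1.3]) with `G = vtPolytope`, `M = constraintSet`: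

* `vtSublevel_subset_regionOfAttraction` — **the theorem**: well-formed structure-preserving data on
  `n ≠ 0` buses (`Mᵢ > 0` on generators, `= 0` on loads, EVERY `Dᵢ > 0` — damping pattern arbitrary —,
  `bᵢⱼ = bⱼᵢ ≥ 0`), preconnected coupling graph, a synchronous equilibrium `δ₀` with coupled line angles
  `|δ₀ᵢ − δ₀ⱼ| < π/2`, a level `c` below `bᵢⱼ·vtGap(δ₀ᵢ − δ₀ⱼ)` on every coupled pair: from every phase
  point `y` of `S = {V ≤ c} ∩ 𝒫 ∩ {L = L(δ₀, 0), ω = 0 off gen}` a global solution of the phase field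
  exists and EVERY global solution from `y` stays in `S` for all `t ≥ 0` and tends to `(δ₀, 0)`;
* `tendsto_of_isSolution_vt` — read on model-2's printed second-order solution notion
  `p.shifted.IsSolution` (frame rotating at `ω₀`): bus angles `→ δ₀`, generator frequency deviations
  `→ 0`, the polytope and `V ≤ c` kept for all `t ≥ 0`;
* `tendsto_of_isSolution_syncFreq_vt` — in the ORIGINAL frame: `δᵢ(t) − ω₀t → δ₀ᵢ` at every bus and
  `δ̇ᵢ(t) → ω₀ = Σ P⁰ᵢ/Σ Dᵢ` at every generator [cite: Padiyar2013, §3.2 eqs (3.3)–(3.5)];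
* `levelBound_window_le_edge` is NOT claimed (the two thresholds are not ordered term by term); what
  IS recorded is `window_subset_vtPolytope` (part 1): the polytope route acts on a larger angle set.

WHY IT MATTERS (memo §3, G2.b tier): the certified LEVEL of an SP instance rises from the window
bound to `min_e b_e·vtGap(σ*_e)` — for NE39-SP49 (column LF) from `29/10` (p481288) to `19`
(`Bench/NE39SPPolytopeRoa.lean`), with no SDP, no Gram certificate and no `decide` beyond rational
comparisons, for EVERY damping vector `D > 0`. With `gen = univ` the same theorem is the solver-free
synchronisation sentence for the network-reduced classical model with NON-UNIFORM damping and ANY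
(sparse or dense) lossless coupling graph, in absolute coordinates on the momentum leaf — the content
the brief «LFF-NU-SPARSE» asked for, inverse-free (no `Ñ⁻¹`, no rank-one level facts; compare
`RelativeLffNonUniformRoa.synchronisation_of_state`, p526132, on Pai's machine-reference space).
THREE COLUMNS: CERTIFIED (kernel) = the statements below about MODEL MV-3 (MODEL-VALIDITY.md; with
`gen = univ` MV-2L) and the CLASS = the well `S`; inner estimate; VALIDATED nothing; no sentence here
says that any grid is stable. No definition, no named fact; standard axioms.
-/

noncomputable section

open Set Filter Topology Real
open Summit.Ventures.GridStability.Models.StructurePreserving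
open Summit.Ventures.GridStability.Models.StructurePreserving.Params
open Literature.MathematicalPhysics.PowerSystems.ClassicalModel.LosslessSystem (vtGap)

namespace Summit.Ventures.GridStability.Lyapunov.StructurePreserving

variable {n : ℕ}

/-! ### The region-of-attraction theorem on the polytope (a priori, all solutions) -/

/-- **Synchronisation of the structure-preserving model from Vu–Turitsyn's polytope, with the
closed-form per-edge level** (MODEL MV-3; [cite: VuTuritsyn2016, §IV (ℛ = {x ∈ 𝒫 : V < V_min}) and
Appendix 9.2–9.3]; [cite: BergenHill1981]). DATA: well-formed structure-preserving data `p` on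
`n ≠ 0` buses (`Mᵢ > 0` on generators, `= 0` on loads, every `Dᵢ > 0`, `bᵢⱼ = bⱼᵢ`), susceptive
couplings `bᵢⱼ ≥ 0`, a PRECONNECTED coupling graph; a synchronous equilibrium `δ₀` of the shifted
model (`fᵢ(δ₀) = P̄ᵢ`) with `|δ₀ᵢ − δ₀ⱼ| < π/2` on coupled pairs; a level `c` with
`c < bᵢⱼ·vtGap(δ₀ᵢ − δ₀ⱼ)` on every coupled pair. STATEMENT: for every phase point `y = (δ, ω)` with
every coupled line angle in the polytope `|(δᵢ − δⱼ) + (δ₀ᵢ − δ₀ⱼ)| < π`, `L(δ, ω) = L(δ₀, 0)`,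
`ωᵢ = 0` at load buses and `V(δ, ω) ≤ c`: (a) some global solution of `X' = F(X)` (`phaseField`, tree
convention) starts at `y`; (b) EVERY global solution from `y` keeps, for all `t ≥ 0`, the polytope,
the constraints and `V ≤ c`, and tends to `(δ₀, 0)`. Proof:
`Literature.Analysis.ODE.sublevel_subset_regionOfAttraction_of_noCompleteTrajectory` with
`G = vtPolytope`, `M = constraintSet`, `V' = fderiv V` (`V̇ = −Σ Dᵢ δ̇ᵢ² ≤ 0` everywhere),
compactness `isCompact_vtSublevel`, `F ∈ C¹`, invariance of `M` (`mem_constraintSet_of_solution`) and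
(iii) `eq_equilibrium_of_fderiv_eq_zero_vtPolytope`. No sentence here says a grid is stable.
[cite: RoucheHabetsLaloy1977, Ch. II Thm 1.3] -/
theorem vtSublevel_subset_regionOfAttraction {p : Params n} (hp : p.WellFormed) (hn : n ≠ 0)
    (hconn : p.couplingGraph.Preconnected) (hb : ∀ i j, 0 ≤ p.b i j)
    {δ₀ : Fin n → ℝ} (h0 : ∀ i j, p.b i j ≠ 0 → |δ₀ i - δ₀ j| < π / 2)
    (hδ₀ : p.IsSyncEquilibrium δ₀) {c : ℝ}
    (hc : ∀ i j, p.b i j ≠ 0 → c < p.b i j * vtGap (δ₀ i - δ₀ j))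
    {y : (Fin n → ℝ) × (Fin n → ℝ)}
    (hy : y ∈ vtPolytope p δ₀ ∩ constraintSet p δ₀ ∧ phaseEnergy p δ₀ y ≤ c) :
    (∃ X : ℝ → (Fin n → ℝ) × (Fin n → ℝ), X 0 = y ∧
      ∀ T : ℝ, ∀ t ∈ Icc 0 T, HasDerivWithinAt X (phaseField p (X t)) (Icc 0 T) t) ∧
    ∀ X : ℝ → (Fin n → ℝ) × (Fin n → ℝ), X 0 = y →
      (∀ T : ℝ, ∀ t ∈ Icc 0 T, HasDerivWithinAt X (phaseField p (X t)) (Icc 0 T) t) →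
      (∀ t, 0 ≤ t → X t ∈ vtPolytope p δ₀ ∩ constraintSet p δ₀ ∧ phaseEnergy p δ₀ (X t) ≤ c) ∧
        Tendsto X atTop (𝓝 (δ₀, 0)) :=
  Literature.Analysis.ODE.sublevel_subset_regionOfAttraction_of_noCompleteTrajectory
    (F := phaseField p) (V := phaseEnergy p δ₀) (V' := fderiv ℝ (phaseEnergy p δ₀))
    (G := vtPolytope p δ₀) (M := constraintSet p δ₀) (isOpen_vtPolytope p δ₀)
    (fun x _ => (((contDiff_phaseEnergy p δ₀).differentiable one_ne_zero) x).hasFDerivAt)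
    (fun x _ => fderiv_phaseEnergy_phaseField_nonpos hp hδ₀ x)
    (isCompact_vtSublevel hp hn hconn hb (fun i j hij => (h0 i j hij).le) hc) (contDiff_phaseField p)
    (fun _ hY0 hY hzero =>
      eq_equilibrium_of_fderiv_eq_zero_vtPolytope hp hn hconn hb h0 hδ₀ hY0.1 hY hzero)
    (fun z hz _ X hX0 hX => mem_constraintSet_of_solution hp hn δ₀ hX (by rw [hX0]; exact hz.1.2))
    hy

/-- **The equilibrium state itself lies in the well** (so the certified set is a neighbourhood of
`(δ₀, 0)` inside the leaf whenever `c > 0`): `(δ₀, 0) ∈ vtPolytope ∩ constraintSet` and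
`V(δ₀, 0) = 0 ≤ c` for `0 ≤ c`. [folklore] -/
theorem equilibrium_mem_vtSublevel (p : Params n) {δ₀ : Fin n → ℝ}
    (h0 : ∀ i j, p.b i j ≠ 0 → |δ₀ i - δ₀ j| < π / 2) {c : ℝ} (hc : 0 ≤ c) :
    ((δ₀, 0) : (Fin n → ℝ) × (Fin n → ℝ)) ∈ vtPolytope p δ₀ ∩ constraintSet p δ₀ ∧
      phaseEnergy p δ₀ ((δ₀, 0) : (Fin n → ℝ) × (Fin n → ℝ)) ≤ c := by
  refine ⟨⟨equilibrium_mem_vtPolytope p h0, equilibrium_mem_constraintSet p δ₀⟩, ?_⟩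
  have hV : phaseEnergy p δ₀ ((δ₀, 0) : (Fin n → ℝ) × (Fin n → ℝ)) = 0 := by
    simp [phaseEnergy, Params.energy, Params.kinetic, Params.potential]
  rw [hV]
  exact hc

/-! ### Back to the printed second-order form -/

/-- **The polytope theorem in the printed vocabulary (frame rotating at `ω₀`).** Under the data
hypotheses of `vtSublevel_subset_regionOfAttraction`, every solution `δ` of the shifted
structure-preserving model (model-2's `p.shifted.IsSolution`, all times) whose initial state has every
coupled line angle in the polytope `|(δᵢ(0) − δⱼ(0)) + (δ₀ᵢ − δ₀ⱼ)| < π`, momentum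
`L(δ(0), δ̇(0)) = L(δ₀, 0)` and energy `V(δ(0), δ̇(0)) ≤ c`, keeps `V ≤ c` and the polytope for all
`t ≥ 0`, and converges: `δ(t) → δ₀` (every bus angle) and `δ̇ᵢ(t) → 0` (every generator frequency
deviation). MODEL MV-3; no sentence here says a grid is stable.
[cite: VuTuritsyn2016, §IV; Padiyar2013, §3.2 Remark 2] -/
theorem tendsto_of_isSolution_vt {p : Params n} (hp : p.WellFormed) (hn : n ≠ 0)
    (hconn : p.couplingGraph.Preconnected) (hb : ∀ i j, 0 ≤ p.b i j)
    {δ₀ : Fin n → ℝ} (h0 : ∀ i j, p.b i j ≠ 0 → |δ₀ i - δ₀ j| < π / 2)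
    (hδ₀ : p.IsSyncEquilibrium δ₀) {c : ℝ}
    (hc : ∀ i j, p.b i j ≠ 0 → c < p.b i j * vtGap (δ₀ i - δ₀ j))
    {δ : ℝ → Fin n → ℝ} (hδ : p.shifted.IsSolution δ)
    (hpol : ∀ i j, p.b i j ≠ 0 → |(δ 0 i - δ 0 j) + (δ₀ i - δ₀ j)| < π)
    (hL : p.momentum (δ 0) (fun i => deriv (fun u => δ u i) 0) = p.momentum δ₀ 0)
    (hV : p.energy δ₀ (δ 0) (fun i => deriv (fun u => δ u i) 0) ≤ c) :
    (∀ t, 0 ≤ t → (∀ i j, p.b i j ≠ 0 → |(δ t i - δ t j) + (δ₀ i - δ₀ j)| < π) ∧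
        p.energy δ₀ (δ t) (fun i => deriv (fun u => δ u i) t) ≤ c) ∧
      Tendsto δ atTop (𝓝 δ₀) ∧
      ∀ i ∈ p.gen, Tendsto (fun t => deriv (fun u => δ u i) t) atTop (𝓝 0) := by
  set X : ℝ → (Fin n → ℝ) × (Fin n → ℝ) :=
    fun s => (δ s, fun i => if i ∈ p.gen then deriv (fun u => δ u i) s else 0) with hX
  have hgen : ∀ s, ∀ i ∈ p.gen, (X s).2 i = deriv (fun u => δ u i) s := fun s i hi => by
    simp [hX, hi]
  have hXsol : ∀ T : ℝ, ∀ t ∈ Icc 0 T, HasDerivWithinAt X (phaseField p (X t)) (Icc 0 T) t :=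
    fun T t _ => (hasDerivAt_phase_of_isSolution hp hδ t).hasDerivWithinAt
  have hy : X 0 ∈ vtPolytope p δ₀ ∩ constraintSet p δ₀ ∧ phaseEnergy p δ₀ (X 0) ≤ c := by
    refine ⟨⟨hpol, ?_, fun i hi => by simp [hX, hi]⟩, ?_⟩
    · rw [momentum_congr_gen p (δ 0) (hgen 0)]
      exact hL
    · rw [phaseEnergy_apply, energy_congr_gen p δ₀ (δ 0) (hgen 0)]
      exact hV
  obtain ⟨-, hall⟩ := vtSublevel_subset_regionOfAttraction hp hn hconn hb h0 hδ₀ hc hy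
  obtain ⟨hstay, hlim⟩ := hall X rfl hXsol
  refine ⟨fun t ht => ⟨(hstay t ht).1.1, ?_⟩, ?_, fun i hi => ?_⟩
  · rw [← energy_congr_gen p δ₀ (δ t) (hgen t)]
    exact (hstay t ht).2
  · have h := (continuous_fst.tendsto _).comp hlim
    simpa [hX, Function.comp_def] using h
  · have h := (((continuous_apply i).comp continuous_snd).tendsto _).comp hlim
    simpa [hX, hi, Function.comp_def] using h

/-- **The polytope theorem in the original frame: synchronisation at the frequency `ω₀`.** Under the
data hypotheses of `vtSublevel_subset_regionOfAttraction`, every solution `δ` of the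
structure-preserving model AS PRINTED (model-2's `p.IsSolution`, powers `P⁰`) whose initial state has
every coupled line angle in the polytope, `L(δ(0), δ̇(0) − ω₀) = L(δ₀, 0)` and
`V(δ(0), δ̇(0) − ω₀) ≤ c`, satisfies `δᵢ(t) − ω₀ t → δ₀ᵢ` at every bus and
`δ̇ᵢ(t) → ω₀ = Σ P⁰ᵢ / Σ Dᵢ` at every generator (via model-2's rotating-frame lemma
`IsSolution.shift`). MODEL MV-3; no sentence here says a grid is stable.
[cite: Padiyar2013, §3.2 eqs (3.3)–(3.5), Remark 2; VuTuritsyn2016, §IV] -/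
theorem tendsto_of_isSolution_syncFreq_vt {p : Params n} (hp : p.WellFormed) (hn : n ≠ 0)
    (hconn : p.couplingGraph.Preconnected) (hb : ∀ i j, 0 ≤ p.b i j)
    {δ₀ : Fin n → ℝ} (h0 : ∀ i j, p.b i j ≠ 0 → |δ₀ i - δ₀ j| < π / 2)
    (hδ₀ : p.IsSyncEquilibrium δ₀) {c : ℝ}
    (hc : ∀ i j, p.b i j ≠ 0 → c < p.b i j * vtGap (δ₀ i - δ₀ j))
    {δ : ℝ → Fin n → ℝ} (hδ : p.IsSolution δ)
    (hpol : ∀ i j, p.b i j ≠ 0 → |(δ 0 i - δ 0 j) + (δ₀ i - δ₀ j)| < π)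
    (hL : p.momentum (δ 0) (fun i => deriv (fun u => δ u i) 0 - p.syncFreq) = p.momentum δ₀ 0)
    (hV : p.energy δ₀ (δ 0) (fun i => deriv (fun u => δ u i) 0 - p.syncFreq) ≤ c) :
    Tendsto (fun t => fun i => δ t i - p.syncFreq * t) atTop (𝓝 δ₀) ∧
      ∀ i ∈ p.gen, Tendsto (fun t => deriv (fun u => δ u i) t) atTop (𝓝 p.syncFreq) := by
  have hs := hδ.shift
  have hderiv : ∀ i t, deriv (fun s => δ s i - p.syncFreq * s) t
      = deriv (fun s => δ s i) t - p.syncFreq := by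
    intro i t
    have h1 := ((hδ.differentiable i) t).hasDerivAt
    have h2 : HasDerivAt (fun s : ℝ => p.syncFreq * s) p.syncFreq t := by
      simpa using (hasDerivAt_id t).const_mul p.syncFreq
    exact (h1.sub h2).deriv
  have hpol' : ∀ i j, p.b i j ≠ 0 →
      |((δ 0 i - p.syncFreq * 0) - (δ 0 j - p.syncFreq * 0)) + (δ₀ i - δ₀ j)| < π := by
    simpa using hpol
  have hL' : p.momentum (fun i => δ 0 i - p.syncFreq * 0)
      (fun i => deriv (fun u => δ u i - p.syncFreq * u) 0) = p.momentum δ₀ 0 := by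
    simpa [hderiv] using hL
  have hV' : p.energy δ₀ (fun i => δ 0 i - p.syncFreq * 0)
      (fun i => deriv (fun u => δ u i - p.syncFreq * u) 0) ≤ c := by
    simpa [hderiv] using hV
  obtain ⟨-, hlim, hfreq⟩ := tendsto_of_isSolution_vt hp hn hconn hb h0 hδ₀ hc hs hpol' hL' hV'
  refine ⟨hlim, fun i hi => ?_⟩
  have h := (hfreq i hi).add_const p.syncFreq
  simpa [hderiv] using h

end Summit.Ventures.GridStability.Lyapunov.StructurePreserving

end
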